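import Summits.CriticalPhenomena.CardyFormulaZ2.Theorems.CardyIKTransportIKMixedBoxCrossingTransportDefs
import Summits.CriticalPhenomena.CardyFormulaZ2.Theorems.CardyIKTransportIKMixedBoxCrossingStubHoneycombRSW

/-!
# Stub `stub_triCylArcs` (line `defect-closure-exploration`, reshape v4, lead c4; crux stmt-CriticalPhenomena-5911)

`TriCylArcs`: for the ALL-HONEYCOMB cylinder slab `Fin (w+1) × ℤ/8n`, `w = (n-1)/2`, the two antipodal arcs of the
left column are black-joined inside the slab with probability `≥ c > 0` uniformly in `n ≥ 1`.  Route: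
1. LAW (`cylProb_hon_eq`): with every face honeycomb the slab weight is the indicator of "all flags anti", so
   `cylProb w L (fun _ => false) E` is the uniform colouring of the cells, i.e. the `P_{1/2}` site percolation
   probability (`sitePercolation (Site 2) half`, `sitePercolation_real_eq_sum`) of the colours read on the sites
   `[0, w] × [0, L)` of `ℤ²` (`honCfg`);
2. GRAPH (`adj_proj`, `blackConn_of_pathIn`): with all flags anti the slab triangulation is `𝕋 = triGraph` drawn on
   `[0, w] × [0, L)` (no event below wraps around the cylinder);
3. GLUING (`honCfg_mem_arcsEvent`): LR crossings of `[0, w] × [2n, 3n-1]`, `[0, w] × [5n, 6n-1]` and a BT crossing of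
   `[0, w] × [2n, 6n-1]` give the arcs event (`PathIn.exists_slab_crossing`, `PathIn.tri_crossings_meet`);
4. PROBABILITY (`prod_le_cylArcs`, `exists_const_le_prod`): Harris–FKG (`sitePercolation_harris'`) and RSW on `𝕋`
   (`exists_rsw_const`, width antitonicity, chaining `pow_mul_pow_le_triLRCrossingProb_of_le` at aspect ratio `≤ 15`
   for `n ≥ 3`; two fixed positive crossing probabilities for `n ≤ 2`).
The `def`s of `TriCylArcsProof` are proof-local bookkeeping (cells ↔ sites of `ℤ²`); nothing of the tree is restated.
-/

noncomputable section

namespace Summit.CriticalPhenomena.CardyFormulaZ2.Cruxes.IKMixedBoxCrossing.DefectClosureExploration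

open scoped BigOperators Classical
open MeasureTheory Finset
open Literature.Probability.Percolation Literature.Probability.LatticeModels
open Summit.CriticalPhenomena.CardyFormulaZ2.Theorems.IKLinearTransport.PinnedDiagramExchange (faceWeight)

namespace TriCylArcsProof

/-! ## The all-honeycomb slab law is the uniform colouring -/

/-- The cell `(j, r)` of the slab drawn at the site `(j, r.val)` of `ℤ²`. -/
def cellPt {w L : ℕ} (c : Fin (w + 1) × ZMod L) : Site 2 := ![((c.1 : ℕ) : ℤ), ((c.2.val : ℕ) : ℤ)]

/-- First coordinate of `cellPt`. -/
@[simp] theorem cellPt_zero {w L : ℕ} (c : Fin (w + 1) × ZMod L) : cellPt c 0 = ((c.1 : ℕ) : ℤ) := rfl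
/-- Second coordinate of `cellPt`. -/
@[simp] theorem cellPt_one {w L : ℕ} (c : Fin (w + 1) × ZMod L) : cellPt c 1 = ((c.2.val : ℕ) : ℤ) := rfl

/-- Distinct cells are drawn at distinct sites. -/
theorem cellPt_injective (w L : ℕ) [NeZero L] : Function.Injective (cellPt (w := w) (L := L)) := by
  intro c d h
  have h0 := congrFun h 0
  have h1 := congrFun h 1
  simp only [cellPt_zero, cellPt_one, Nat.cast_inj] at h0 h1
  exact Prod.ext (Fin.ext h0) (ZMod.val_injective L h1)

/-- The all-honeycomb slab configuration read from a site configuration of `ℤ²`. -/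
def honCfg (w L : ℕ) (ω : SiteConfig (Site 2)) : CylCfg w L :=
  (fun c => decide (cellPt c ∈ ω), fun _ => true)

/-- The finite set of sites carrying the slab. -/
def cellFinset (w L : ℕ) [NeZero L] : Finset (Site 2) :=
  Finset.univ.image (cellPt (w := w) (L := L))

/-- Every cell is drawn on a carrying site. -/
theorem cellPt_mem {w L : ℕ} [NeZero L] (c : Fin (w + 1) × ZMod L) : cellPt c ∈ cellFinset w L :=
  Finset.mem_image_of_mem _ (Finset.mem_univ _)

/-- There are as many carrying sites as cells. -/
theorem card_cellFinset (w L : ℕ) [NeZero L] :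
    (cellFinset w L).card = Fintype.card (Fin (w + 1) × ZMod L) := by
  rw [cellFinset, Finset.card_image_of_injective _ (cellPt_injective w L), Finset.card_univ]

/-- The cells of the slab and the sites carrying them correspond bijectively. -/
def cellEquiv (w L : ℕ) [NeZero L] : (Fin (w + 1) × ZMod L) ≃ ↥(cellFinset w L) :=
  Equiv.ofBijective (fun c => ⟨cellPt c, cellPt_mem c⟩)
    ⟨fun c d h => cellPt_injective w L (Subtype.ext_iff.1 h), fun ⟨v, hv⟩ => by
      obtain ⟨c, -, rfl⟩ := Finset.mem_image.1 hv
      exact ⟨c, rfl⟩⟩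

/-- With every face honeycomb the slab weight is the indicator of 'all flags anti'. -/
theorem cylWeight_hon {w L : ℕ} [NeZero L] (x : CylCfg w L) :
    cylWeight w L (fun _ => false) x = if x.2 = fun _ => true then (1 : ℝ) else 0 := by
  unfold cylWeight
  simp only [faceWeight, if_false, Bool.false_eq_true]
  rw [Finset.prod_boole]
  congr 1
  simp [funext_iff]

/-- The numerator of `cylProb` for the all-honeycomb slab counts colourings. -/
theorem sum_hon {w L : ℕ} [NeZero L] (E : Set (CylCfg w L)) :
    (∑ x : CylCfg w L, if x ∈ E then cylWeight w L (fun _ => false) x else 0) =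
      ∑ col : Fin (w + 1) × ZMod L → Bool, if (col, fun _ => true) ∈ E then (1 : ℝ) else 0 := by
  simp_rw [cylWeight_hon]
  rw [Fintype.sum_prod_type]
  refine Finset.sum_congr rfl fun col _ => ?_
  rw [show (∑ b : Fin w × ZMod L → Bool,
      if (col, b) ∈ E then (if b = fun _ => true then (1 : ℝ) else 0) else 0) =
      ∑ b : Fin w × ZMod L → Bool, if b = (fun _ => true) then (if (col, b) ∈ E then (1 : ℝ) else 0) else 0 from
    Finset.sum_congr rfl fun b _ => by split_ifs <;> rfl]
  rw [Finset.sum_ite_eq']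
  simp

/-- The partition function of the all-honeycomb slab is the number of colourings. -/
theorem cylZ_hon (w L : ℕ) [NeZero L] :
    cylZ w L (fun _ => false) = Fintype.card (Fin (w + 1) × ZMod L → Bool) := by
  unfold cylZ
  simp_rw [cylWeight_hon]
  rw [Fintype.sum_prod_type]
  simp_rw [Finset.sum_ite_eq', Finset.mem_univ, if_true]
  simp

/-- Events read through `honCfg` are determined by the carrying sites. -/
theorem determinedBy_honCfg (w L : ℕ) [NeZero L] (E : Set (CylCfg w L)) :
    DeterminedBy (honCfg w L ⁻¹' E) ↑(cellFinset w L) := by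
  rw [determinedBy_iff]
  intro ω ω' h
  simp only [Set.mem_preimage]
  suffices he : honCfg w L ω = honCfg w L ω' by rw [he]
  refine Prod.ext (funext fun c => ?_) rfl
  have := Set.ext_iff.1 h (cellPt c)
  simp only [Set.mem_inter_iff, Finset.mem_coe, cellPt_mem, and_true] at this
  simp [honCfg, this]

/-- At `p = 1/2` every configuration on `F` has weight `2^{-|F|}`. -/
theorem siteWeight_half {F : Finset (Site 2)} (y : ↥F → Prop) :
    siteWeight half y = (1 / 2 : ℝ) ^ F.card := by
  unfold siteWeight
  rw [← Fintype.card_coe, ← Finset.card_univ, ← Finset.prod_const]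
  refine Finset.prod_congr rfl fun i _ => ?_
  by_cases h : y i
  · rw [show ({y i} : Set Prop) = {True} by rw [eq_true h], bernoulliProp_real_true]; norm_num [half]
  · rw [show ({y i} : Set Prop) = {False} by rw [eq_false h], bernoulliProp_real_false]; norm_num [half]

/-- The configurations on the carrying sites correspond to colourings of the slab. -/
def cfgEquiv (w L : ℕ) [NeZero L] : (↥(cellFinset w L) → Prop) ≃ (Fin (w + 1) × ZMod L → Bool) :=
  (cellEquiv w L).symm.arrowCongr Equiv.propEquivBool

/-- `cfgEquiv` in coordinates. -/
theorem cfgEquiv_apply (w L : ℕ) [NeZero L] (y : ↥(cellFinset w L) → Prop) (c : Fin (w + 1) × ZMod L) :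
    cfgEquiv w L y c = decide (y (cellEquiv w L c)) := by
  simp [cfgEquiv, Equiv.arrowCongr_apply, Equiv.propEquivBool]

/-- The trace of an event read through `honCfg` is the event itself, along `cfgEquiv`. -/
theorem mem_traceEvent_iff (w L : ℕ) [NeZero L] (E : Set (CylCfg w L)) (y : ↥(cellFinset w L) → Prop) :
    y ∈ traceEvent (cellFinset w L) (honCfg w L ⁻¹' E) ↔ (cfgEquiv w L y, fun _ => true) ∈ E := by
  simp only [traceEvent, Set.mem_setOf_eq, Set.mem_preimage]
  suffices h : honCfg w L {v | liftSiteConfig (cellFinset w L) y v} = (cfgEquiv w L y, fun _ => true) by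
    rw [h]
  refine Prod.ext (funext fun c => ?_) rfl
  simp only [honCfg, Set.mem_setOf_eq, liftSiteConfig, cfgEquiv_apply]
  congr 1
  exact propext ⟨fun ⟨_, h⟩ => h, fun h => ⟨cellPt_mem c, h⟩⟩

/-- **The all-honeycomb slab law is the uniform colouring**: `cylProb w L (fun _ => false) E` is the
`P_{1/2}`-probability (site percolation on `ℤ²`) that the colours read on `[0, w] × [0, L)` together with
all-anti flags lie in `E`. -/
theorem cylProb_hon_eq (w L : ℕ) [NeZero L] (E : Set (CylCfg w L)) :
    cylProb w L (fun _ => false) E = (sitePercolation (Site 2) half).real (honCfg w L ⁻¹' E) := by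
  have key : (∑ col : Fin (w + 1) × ZMod L → Bool, if (col, fun _ => true) ∈ E then (1 : ℝ) else 0) /
      (Fintype.card (Fin (w + 1) × ZMod L → Bool) : ℝ) =
      ∑ col : Fin (w + 1) × ZMod L → Bool, if (col, fun _ => true) ∈ E then
        (1 / 2 : ℝ) ^ Fintype.card (Fin (w + 1) × ZMod L) else 0 := by
    rw [Finset.sum_div]
    refine Finset.sum_congr rfl fun col _ => ?_
    rw [Fintype.card_fun, Fintype.card_bool]
    split_ifs
    · rw [one_div_pow, Nat.cast_pow]; norm_num
    · rw [zero_div]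
  have hre : (∑ y : ↥(cellFinset w L) → Prop, if (cfgEquiv w L y, fun _ => true) ∈ E then
        (1 / 2 : ℝ) ^ Fintype.card (Fin (w + 1) × ZMod L) else 0) =
      ∑ col : Fin (w + 1) × ZMod L → Bool, if (col, fun _ => true) ∈ E then
        (1 / 2 : ℝ) ^ Fintype.card (Fin (w + 1) × ZMod L) else 0 :=
    Equiv.sum_comp (cfgEquiv w L) (fun col : Fin (w + 1) × ZMod L → Bool =>
      if (col, fun _ => true) ∈ E then (1 / 2 : ℝ) ^ Fintype.card (Fin (w + 1) × ZMod L) else 0)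
  rw [cylProb, sum_hon, cylZ_hon, sitePercolation_real_eq_sum half (determinedBy_honCfg w L E),
    Finset.sum_filter]
  simp_rw [siteWeight_half, card_cellFinset, mem_traceEvent_iff]
  refine (key.trans hre.symm).trans (Finset.sum_congr (by ext; simp) fun y _ => by split_ifs <;> rfl)

/-! ## Paths of the planar box become black paths of the slab -/

/-- The cell of the slab carried by a site of `[0, w] × [0, L)`. -/
def proj (w L : ℕ) (z : Site 2) : Fin (w + 1) × ZMod L :=
  (⟨(z 0).toNat % (w + 1), Nat.mod_lt _ (Nat.succ_pos w)⟩, ((z 1 : ℤ) : ZMod L))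

/-- The row of `proj`. -/
@[simp] theorem proj_snd (w L : ℕ) (z : Site 2) : (proj w L z).2 = ((z 1 : ℤ) : ZMod L) := rfl

/-- The column of `proj` on `[0, w] × ℤ`. -/
theorem proj_fst_val {w : ℕ} (L : ℕ) {z : Site 2} (h0 : 0 ≤ z 0) (hw : z 0 ≤ w) :
    (((proj w L z).1 : ℕ) : ℤ) = z 0 := by
  simp only [proj]
  rw [Nat.mod_eq_of_lt (by omega)]
  omega

/-- The row of `proj` on `ℤ × [0, L)`. -/
theorem proj_snd_val (w : ℕ) {L : ℕ} [NeZero L] {z : Site 2} (h0 : 0 ≤ z 1) (hL : z 1 < L) :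
    (((proj w L z).2.val : ℕ) : ℤ) = z 1 := by
  rw [proj_snd, ZMod.val_intCast]
  exact Int.emod_eq_of_lt h0 hL

/-- `proj` inverts `cellPt` on `[0, w] × [0, L)`. -/
theorem cellPt_proj {w L : ℕ} [NeZero L] {z : Site 2} (h : 0 ≤ z 0 ∧ z 0 ≤ w ∧ 0 ≤ z 1 ∧ z 1 < L) :
    cellPt (proj w L z) = z := by
  rw [Site.eq_iff_two, cellPt_zero, cellPt_one]
  exact ⟨proj_fst_val L h.1 h.2.1, proj_snd_val w h.2.2.1 h.2.2.2⟩

/-- A step of `𝕋` inside `[0, w] × [0, L)` is a step of the all-anti triangulation of the slab. -/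
theorem adj_proj {w L : ℕ} [NeZero L] {s t : Site 2}
    (hs : 0 ≤ s 0 ∧ s 0 ≤ w ∧ 0 ≤ s 1 ∧ s 1 < L) (ht : 0 ≤ t 0 ∧ t 0 ≤ w ∧ 0 ≤ t 1 ∧ t 1 < L)
    (h : triGraph.Adj s t) : (cylGraph w L fun _ => true).Adj (proj w L s) (proj w L t) := by
  have hne : proj w L s ≠ proj w L t := fun e => h.ne (by rw [← cellPt_proj hs, ← cellPt_proj ht, e])
  have hs0 := proj_fst_val L hs.1 hs.2.1
  have ht0 := proj_fst_val L ht.1 ht.2.1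
  rw [cylGraph, SimpleGraph.fromRel_adj]
  refine ⟨hne, ?_⟩
  simp only [proj_snd, and_true, Bool.true_eq_false, and_false, exists_false, false_or]
  rcases triGraph_adj_cases h with ⟨h0, h1⟩ | ⟨h0, h1⟩ | ⟨h1, h0⟩ | ⟨h1, h0⟩ | ⟨h0, h1⟩ | ⟨h0, h1⟩
  · exact Or.inl (Or.inr (Or.inl ⟨by omega, by rw [h1]⟩))
  · exact Or.inr (Or.inr (Or.inl ⟨by omega, by rw [h1]⟩))
  · exact Or.inl (Or.inl ⟨Fin.ext (by omega), by rw [h1]; push_cast; ring⟩)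
  · exact Or.inr (Or.inl ⟨Fin.ext (by omega), by rw [h1]; push_cast; ring⟩)
  · refine Or.inl (Or.inr (Or.inr ⟨⟨(proj w L s).1, by omega⟩, Fin.ext rfl, Fin.ext (by simp; omega),
      by rw [h1]; push_cast; ring⟩))
  · refine Or.inr (Or.inr (Or.inr ⟨⟨(proj w L t).1, by omega⟩, Fin.ext rfl, Fin.ext (by simp; omega),
      by rw [h1]; push_cast; ring⟩))

/-- A `𝕋`-path of sites of `ω` inside `[0, w] × [0, L)` is a black path of the slab configuration
`honCfg w L ω`. -/
theorem blackConn_of_pathIn {w L : ℕ} [NeZero L] {ω A : Set (Site 2)}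
    (hA : ∀ z ∈ A, (0 ≤ z 0 ∧ z 0 ≤ w ∧ 0 ≤ z 1 ∧ z 1 < L) ∧ z ∈ ω) {a b : Site 2}
    (h : PathIn triGraph A a b) : BlackConn (honCfg w L ω) (proj w L a) (proj w L b) := by
  have hblack : ∀ z ∈ A, (honCfg w L ω).1 (proj w L z) = true := fun z hz => by
    simp [honCfg, cellPt_proj (hA z hz).1, (hA z hz).2]
  obtain ⟨ha, hab⟩ := h
  suffices key : ∀ b, Relation.ReflTransGen (fun x y => triGraph.Adj x y ∧ y ∈ A) a b → ∀ hb : b ∈ A,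
      ((cylGraph w L (honCfg w L ω).2).induce {c | (honCfg w L ω).1 c = true}).Reachable
        ⟨proj w L a, hblack a ha⟩ ⟨proj w L b, hblack b hb⟩ from
    ⟨hblack a ha, hblack b (PathIn.right_mem ⟨ha, hab⟩), key b hab (PathIn.right_mem ⟨ha, hab⟩)⟩
  intro b hab
  induction hab with
  | refl => exact fun _ => SimpleGraph.Reachable.refl _
  | @tail c d hac hcd ih =>
    intro hd
    have hc : c ∈ A := PathIn.right_mem ⟨ha, hac⟩
    refine (ih hc).trans (SimpleGraph.Adj.reachable ?_)
    simp only [SimpleGraph.induce_adj]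
    exact adj_proj (hA c hc).1 (hA d hd).1 hcd.1


/-- **Gluing.** Left-right crossings of `[0, w] × [2n, 3n-1]` and of `[0, w] × [5n, 6n-1]` and a bottom-top
crossing of `[0, w] × [2n, 6n-1]` by sites of `ω` join, inside the slab, a cell of the left column with row in
`[2n, 3n)` to one with row in `[5n, 6n)`: the vertical crossing crosses both small boxes bottom-to-top
(`PathIn.exists_slab_crossing`) and meets the horizontal crossings there (`PathIn.tri_crossings_meet`). -/
theorem honCfg_mem_arcsEvent {n : ℕ} (hn : 1 ≤ n) (w : ℕ) [NeZero (8 * n)] {ω : Set (Site 2)}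
    (hH₁ : ω ∈ triHCross 0 (2 * n) w (n - 1)) (hH₂ : ω ∈ triHCross 0 (5 * n) w (n - 1))
    (hV : ω ∈ triVCross 0 (2 * n) w (4 * n - 1)) :
    honCfg w (8 * n) ω ∈ arcsEvent w (8 * n) n := by
  obtain ⟨a₁, b₁, ha₁, hb₁, hP₁⟩ := hH₁
  obtain ⟨a₂, b₂, ha₂, hb₂, hP₂⟩ := hH₂
  obtain ⟨x, y, hx, hy, hQ⟩ := hV
  obtain ⟨S₁, hS₁, hP₁', hS₁all⟩ := hP₁.exists_support
  obtain ⟨S₂, hS₂, hP₂', hS₂all⟩ := hP₂.exists_support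
  obtain ⟨T, hT, hQ', hTall⟩ := hQ.exists_support
  have bS₁ : ∀ z ∈ S₁, 0 ≤ z 0 ∧ z 0 ≤ w ∧ 2 * n ≤ z 1 ∧ z 1 ≤ 3 * n - 1 ∧ z ∈ ω := fun z hz => by
    obtain ⟨hz, hzω⟩ := hS₁ hz
    simp only [mem_triStrip] at hz
    exact ⟨by omega, by omega, by omega, by omega, hzω⟩
  have bS₂ : ∀ z ∈ S₂, 0 ≤ z 0 ∧ z 0 ≤ w ∧ 5 * n ≤ z 1 ∧ z 1 ≤ 6 * n - 1 ∧ z ∈ ω := fun z hz => by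
    obtain ⟨hz, hzω⟩ := hS₂ hz
    simp only [mem_triStrip] at hz
    exact ⟨by omega, by omega, by omega, by omega, hzω⟩
  have bT : ∀ z ∈ T, 0 ≤ z 0 ∧ z 0 ≤ w ∧ 2 * n ≤ z 1 ∧ z 1 ≤ 6 * n - 1 ∧ z ∈ ω := fun z hz => by
    obtain ⟨hz, hzω⟩ := hT hz
    simp only [mem_triStrip] at hz
    exact ⟨by omega, by omega, by omega, by omega, hzω⟩
  -- the vertical crossing crosses the two small boxes
  obtain ⟨x₁, y₁, hx₁, hy₁, hQ₁⟩ := hQ'.exists_slab_crossing 1 (L := 2 * n) (R := 3 * n - 1) (by omega)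
    (by rw [hx]) (by rw [hy]; omega)
  obtain ⟨x₂, y₂, hx₂, hy₂, hQ₂⟩ := hQ'.exists_slab_crossing 1 (L := 5 * n) (R := 6 * n - 1) (by omega)
    (by rw [hx]; omega) (by rw [hy]; omega)
  -- where it meets the horizontal crossings
  obtain ⟨z₁, hz₁S, hz₁T⟩ := PathIn.tri_crossings_meet (L := 0) (R := w) (B := 2 * n) (T := 3 * n - 1)
    (A := S₁) (A' := T ∩ {z | 2 * (n : ℤ) ≤ z 1 ∧ z 1 ≤ 3 * n - 1})
    (fun z hz => ⟨(bS₁ z hz).1, (bS₁ z hz).2.1, (bS₁ z hz).2.2.1, (bS₁ z hz).2.2.2.1⟩)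
    (fun z hz => ⟨(bT z hz.1).1, (bT z hz.1).2.1, hz.2.1, hz.2.2⟩) hP₁' ha₁ (by rw [hb₁]; simp) hQ₁ hx₁ hy₁
  obtain ⟨z₂, hz₂S, hz₂T⟩ := PathIn.tri_crossings_meet (L := 0) (R := w) (B := 5 * n) (T := 6 * n - 1)
    (A := S₂) (A' := T ∩ {z | 5 * (n : ℤ) ≤ z 1 ∧ z 1 ≤ 6 * n - 1})
    (fun z hz => ⟨(bS₂ z hz).1, (bS₂ z hz).2.1, (bS₂ z hz).2.2.1, (bS₂ z hz).2.2.2.1⟩)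
    (fun z hz => ⟨(bT z hz.1).1, (bT z hz.1).2.1, hz.2.1, hz.2.2⟩) hP₂' ha₂ (by rw [hb₂]; simp) hQ₂ hx₂ hy₂
  -- the black path `a₁ → z₁ → x → z₂ → a₂` of the slab
  set U : Set (Site 2) := {z | (0 ≤ z 0 ∧ z 0 ≤ w ∧ 0 ≤ z 1 ∧ z 1 < ((8 * n : ℕ) : ℤ)) ∧ z ∈ ω} with hU
  have hS₁U : S₁ ⊆ U := fun z hz => by have := bS₁ z hz; exact ⟨by omega, this.2.2.2.2⟩
  have hS₂U : S₂ ⊆ U := fun z hz => by have := bS₂ z hz; exact ⟨by omega, this.2.2.2.2⟩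
  have hTU : T ⊆ U := fun z hz => by have := bT z hz; exact ⟨by omega, this.2.2.2.2⟩
  have path : PathIn triGraph U a₁ a₂ :=
    (((hS₁all z₁ hz₁S).mono hS₁U).trans
      (((hTall z₁ hz₁T.1).symm.trans (hTall z₂ hz₂T.1)).mono hTU)).trans
      ((hS₂all z₂ hz₂S).symm.mono hS₂U)
  have hconn := blackConn_of_pathIn (w := w) (L := 8 * n) (ω := ω) (A := U) (fun z hz => hz) path
  have ba₁ := bS₁ a₁ hP₁'.left_mem
  have ba₂ := bS₂ a₂ hP₂'.left_mem
  have v₁ := proj_snd_val w (L := 8 * n) (z := a₁) (by omega) (by push_cast; omega)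
  have v₂ := proj_snd_val w (L := 8 * n) (z := a₂) (by omega) (by push_cast; omega)
  have e₁ : proj w (8 * n) a₁ = ((0 : Fin (w + 1)), (proj w (8 * n) a₁).2) :=
    Prod.ext (Fin.ext (by simp [proj, ha₁])) rfl
  have e₂ : proj w (8 * n) a₂ = ((0 : Fin (w + 1)), (proj w (8 * n) a₂).2) :=
    Prod.ext (Fin.ext (by simp [proj, ha₂])) rfl
  rw [e₁, e₂] at hconn
  exact ⟨_, _, by omega, by omega, by omega, by omega, hconn⟩


/-! ## Probability: Harris–FKG and RSW on `𝕋` -/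

/-- **Harris.** `P(H₁) P(H₂) P(V) ≤ cylArcs w (8n) (all honeycomb) n` for the three crossing events of the
gluing lemma (increasing local events of the i.i.d. fair colouring; `sitePercolation_harris'` twice, then the
slab law is that colouring, `cylProb_hon_eq`, and the gluing `honCfg_mem_arcsEvent`). -/
theorem prod_le_cylArcs {n : ℕ} (hn : 1 ≤ n) (w : ℕ) [NeZero (8 * n)] :
    (sitePercolation (Site 2) half).real (triHCross 0 (2 * n) w (n - 1)) *
        (sitePercolation (Site 2) half).real (triHCross 0 (5 * n) w (n - 1)) *
        (sitePercolation (Site 2) half).real (triVCross 0 (2 * n) w (4 * n - 1)) ≤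
      cylArcs w (8 * n) (fun _ => false) n := by
  rw [cylArcs, cylProb_hon_eq]
  have d1 := determinedBy_triHCross 0 (2 * n) w (n - 1)
  have d2 := determinedBy_triHCross 0 (5 * n) w (n - 1)
  have d3 := determinedBy_triVCross 0 (2 * n) w (4 * n - 1)
  have u1 := isUpperSet_triHCross 0 (2 * n) w (n - 1)
  have u2 := isUpperSet_triHCross 0 (5 * n) w (n - 1)
  have u3 := isUpperSet_triVCross 0 (2 * n) w (4 * n - 1)
  have d12 : DeterminedBy (triHCross 0 (2 * n) w (n - 1) ∩ triHCross 0 (5 * n) w (n - 1))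
      ↑(triStripFinset 0 (2 * n) w (n - 1) ∪ triStripFinset 0 (5 * n) w (n - 1)) :=
    (d1.mono (by simp)).inter (d2.mono (by simp))
  have h12 := sitePercolation_harris' half d1 d2 u1 u2
  have h123 := sitePercolation_harris' half d12 d3 (u1.inter u2) u3
  refine ((mul_le_mul_of_nonneg_right h12 measureReal_nonneg).trans h123).trans
    (measureReal_mono ?_ (measure_ne_top _ _))
  rintro ω ⟨⟨h1, h2⟩, h3⟩
  exact honCfg_mem_arcsEvent hn w h1 h2 h3

/-- **RSW input.** A constant `c > 0` below `P(H₁) P(H₂) P(V)` for every `n ≥ 1` and `w = (n-1)/2`: the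
horizontal crossings of the `(w+1) × n` boxes are crossings in the easy direction (`w ≤ 2(n-1)+1`, width
antitonicity and `exists_rsw_const`); the vertical crossing of the `(w+1) × 4n` box is a long-way crossing of
aspect ratio `≤ 15` for `n ≥ 3` (RSW chaining `pow_mul_pow_le_triLRCrossingProb_of_le`), and one of two fixed
positive numbers for `n ≤ 2`. -/
theorem exists_const_le_prod : ∃ c : ℝ, 0 < c ∧ ∀ n : ℕ, 1 ≤ n →
    c ≤ (sitePercolation (Site 2) half).real (triHCross 0 (2 * n) ((n - 1) / 2) (n - 1)) *
        (sitePercolation (Site 2) half).real (triHCross 0 (5 * n) ((n - 1) / 2) (n - 1)) *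
        (sitePercolation (Site 2) half).real (triVCross 0 (2 * n) ((n - 1) / 2) (4 * n - 1)) := by
  obtain ⟨c₀, hc₀, hk⟩ :=
    Summit.CriticalPhenomena.CardyFormulaZ2.Cruxes.IKMixedBoxCrossing.PairedMirrorExploration.HoneycombStub.exists_rsw_const
  have hhalf : 0 < ((half : unitInterval) : ℝ) := by simp [half]
  set cV : ℝ := min (c₀ ^ 14 * c₀ ^ 13) (min (triLRCrossingProb half 3 0) (triLRCrossingProb half 7 0))
    with hcV
  have hcVpos : 0 < cV :=
    lt_min (by positivity) (lt_min (triLRCrossingProb_pos hhalf 3 0) (triLRCrossingProb_pos hhalf 7 0))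
  refine ⟨c₀ * c₀ * cV, by positivity, fun n hn => ?_⟩
  have eH : ∀ b : ℤ, (sitePercolation (Site 2) half).real (triHCross 0 b ((n - 1) / 2) (n - 1)) =
      triLRCrossingProb half ((n - 1) / 2) (n - 1) := fun b =>
    triSitePercolation_real_triHCross half 0 b _ _
  have eV : (sitePercolation (Site 2) half).real (triVCross 0 (2 * n) ((n - 1) / 2) (4 * n - 1)) =
      triLRCrossingProb half (4 * n - 1) ((n - 1) / 2) :=
    triSitePercolation_real_triVCross half 0 _ _ _
  rw [eH, eH, eV]
  have hH : c₀ ≤ triLRCrossingProb half ((n - 1) / 2) (n - 1) :=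
    (hk (n - 1)).trans (triLRCrossingProb_anti_width half (by omega) (n - 1))
  have hV : cV ≤ triLRCrossingProb half (4 * n - 1) ((n - 1) / 2) := by
    rcases Nat.lt_or_ge n 3 with h3 | h3
    · interval_cases n
      · exact (min_le_right _ _).trans (min_le_left _ _)
      · exact (min_le_right _ _).trans (min_le_right _ _)
    · refine (min_le_left _ _).trans ?_
      have h₁ : c₀ ≤ triLRCrossingProb half (2 * ((n - 1) / 2)) ((n - 1) / 2) :=
        (hk _).trans (triLRCrossingProb_anti_width half (by omega) _)
      have h₂ : c₀ ≤ triLRCrossingProb half ((n - 1) / 2) ((n - 1) / 2) :=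
        (hk _).trans (triLRCrossingProb_anti_width half (by omega) _)
      have := pow_mul_pow_le_triLRCrossingProb_of_le half ((n - 1) / 2) hc₀.le hc₀.le h₁ h₂
        (j := 14) (by norm_num) (w := 4 * n - 1) (by omega)
      simpa using this
  have h0 : 0 ≤ triLRCrossingProb half ((n - 1) / 2) (n - 1) := measureReal_nonneg
  calc c₀ * c₀ * cV ≤ triLRCrossingProb half ((n - 1) / 2) (n - 1) * triLRCrossingProb half ((n - 1) / 2) (n - 1)
        * triLRCrossingProb half (4 * n - 1) ((n - 1) / 2) :=
        mul_le_mul (mul_le_mul hH hH hc₀.le h0) hV hcVpos.le (mul_nonneg h0 h0)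
    _ = _ := by ring

end TriCylArcsProof

open TriCylArcsProof in
/-- **Stub `stub_triCylArcs` · TRIANGULAR CYLINDER ARCS.** For the all-honeycomb slab (i.i.d. fair colours,
anti-diagonals: site percolation on `𝕋` drawn on the cylinder slab `Fin (⌈n/2⌉) × ℤ/8n`) the two antipodal arcs of
the left column are black-joined inside the slab with probability bounded below uniformly in `n ≥ 1`: Harris–FKG
for the LR crossings of `[0, w] × [2n, 3n)`, `[0, w] × [5n, 6n)` and the BT crossing of `[0, w] × [2n, 6n)`
(`w = (n-1)/2`; none wraps around the cylinder), glued by `PathIn.tri_crossings_meet`, and RSW on `𝕋`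
(`exists_rsw_const`, `pow_mul_pow_le_triLRCrossingProb_of_le`). -/
theorem stub_triCylArcs : TriCylArcs := by
  obtain ⟨c, hc, h⟩ := exists_const_le_prod
  refine ⟨c, hc, fun n L _ hn hL => ?_⟩
  subst hL
  exact (h n hn).trans (prod_le_cylArcs hn _)

end Summit.CriticalPhenomena.CardyFormulaZ2.Cruxes.IKMixedBoxCrossing.DefectClosureExploration

end
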